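import Literature.AlgebraicGeometry.HodgeTheory.PicardLefschetzExchangedPairOfOneNode
import Literature.AlgebraicGeometry.HodgeTheory.PicardLefschetzNodalFormsKeyedMonomial
import HarnessLib

/-!
# hPL₂exch for PURE MONOMIAL pencil directions `g = xᵢ^d`, unconditionally — the drop-in for the K1-B consumer

Family `hodge`, layer `Literature/AlgebraicGeometry/HodgeTheory`. Theorems only (programme «PL2-MERIDIANS», prover seat
`hodge-nonav-20241-p1` g18, cell `hodge-nonav`; `--supports stmt-HodgeConjecture-19716`). Sequel of
`PicardLefschetzExchangedPairOfOneNode` (hPL₂exch ⟸ hPL₁, and the unconditional instance for `g = a′ • xᵢ^d`): the K1-B consumer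
`SignSymmetricPowersPencilTransvectionsKeyed.transvections_of_exchanged_pair_keyed` applies the named fact
`picardLefschetz_exchangedPair` at the direction `g₃ = x₂^d` (`SignSymmetricPowersMeridianGenerationMonomial`), so the exact drop-in
is the body of `picardLefschetz_exchangedPair` at `g := X i ^ d` (no scalar), which is recorded here, together with the
instantiation from the monomial-keyed one-node fact `picardLefschetz_oneNodeMonomial` (prover-Bx, a THEOREM of the tree).

* `picardLefschetz_exchangedPair_of_oneNodeMonomial` — hPL₂exch's body for `g := a′ • X i ^ d` from `picardLefschetz_oneNodeMonomial`;
* `picardLefschetz_exchangedPair_X_pow` — hPL₂exch's body for `g := X i ^ d`, UNCONDITIONAL;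
* `picardLefschetz_exchangedPair_of_exists_monomial` — hPL₂exch's body for a general `g` with the side hypothesis
  `∃ i a′, g = a′ • X i ^ d` (the consumer shape of `PicardLefschetzOneNodeMonomialShapes`), UNCONDITIONAL, with the port recipe.

Honest scope: Picard–Lefschetz package of route B (`HodgeConjecture/SignSymmetricPowers`); nothing here says HC is proved; rung F-H1
not moved; the general-direction `picardLefschetz_oneNode` / `picardLefschetz_exchangedPair` are not proved here (only
`picardLefschetz_oneNode → picardLefschetz_exchangedPair`, in the prequel).

## References

* [VoisinHodgeII2003] C. Voisin, Hodge Theory and Complex Algebraic Geometry II, CUP 2003, §3.2.1 Thm. 3.16, Cor. 3.17, Rem. 3.21,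
  §2.3.2.
* [ArnoldGuseinzadeVarchenko2012] AGZV II, Part I §1.3, §2.1.
* [Lamotke1981] K. Lamotke, The topology of complex projective varieties after S. Lefschetz, §6.
-/

noncomputable section

open CategoryTheory AlgebraicGeometry MvPolynomial
open scoped unitInterval
open Literature.AlgebraicTopology.SingularHomology
open Literature.AlgebraicGeometry.Motives Literature.AlgebraicGeometry.Motives.UniversalHypersurface
open Literature.AlgebraicGeometry.HodgeTheory.UniversalHypersurface
open Literature.AlgebraicGeometry.HodgeTheory.BettiUniverse

namespace Literature.AlgebraicGeometry.HodgeTheory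

/-- **hPL₂exch for `g = a′ • xᵢ^d` from the monomial-keyed one-node fact** `picardLefschetz_oneNodeMonomial` (which is a theorem:
`picardLefschetz_oneNodeMonomial_holds`): instantiation of the master theorem `picardLefschetz_exchangedPair_of_supplier`.
[cite: VoisinHodgeII2003, §3.2.1 Thm. 3.16, Cor. 3.17, Rem. 3.21 and §2.3.2] [cite: ArnoldGuseinzadeVarchenko2012, Part I §1.3 and §2.1] -/
theorem picardLefschetz_exchangedPair_of_oneNodeMonomial (H : picardLefschetz_oneNodeMonomial) (n d : ℕ) (hn : 1 ≤ n)
    (hd : 1 ≤ d) (f₁ : MvPolynomial (Fin (n + 2)) ℂ) (hf₁ : f₁.IsHomogeneous d) (i : Fin (n + 2)) (a' : ℂ)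
    (p : Fin 2 → Fin (n + 2) → ℂ) (hnod : IsNodalFormWithNodes f₁ p)
    (hgp : ∀ j, eval (p j) (a' • X i ^ d : MvPolynomial (Fin (n + 2)) ℂ) ≠ 0)
    (a : Fin (n + 2) → ℂˣ) (ha₁ : a ∈ diagonalStabilizer f₁)
    (hag : a ∈ diagonalStabilizer (a' • X i ^ d : MvPolynomial (Fin (n + 2)) ℂ)) (h10 : ∃ t : ℂ, a • p 1 = t • p 0) :
    ∃ ε₀ : ℝ, 0 < ε₀ ∧
      (∀ c' : ℂ, c' ≠ 0 → ‖c'‖ < ε₀ →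
        SmoothHypersurface.IsNonsingularForm ℂ (f₁ + c' • (a' • X i ^ d : MvPolynomial (Fin (n + 2)) ℂ))) ∧
      ∀ (hU : IsCohomologicallyLocallyTrivialOn (family ℂ n d) Set.univ) (ε : ℝ), 0 < ε → ε < ε₀ →
        ∀ (s' : ComplexPoints (base ℂ n d)),
          pointForm ℂ n d s' = f₁ + (ε : ℂ) • (a' • X i ^ d : MvPolynomial (Fin (n + 2)) ℂ) →
          ∀ (γ : Path s' s'), IsPencilCircle n d f₁ (a' • X i ^ d) ε γ →
            (Even n → ∀ T : bettiCohomology (fiberOver (family ℂ n d) s') n ≃ₗ[ℚ]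
                bettiCohomology (fiberOver (family ℂ n d) s') n,
              IsRatTransport (family ℂ n d) n hU (loopClassUniv n d γ) T → T ≠ LinearEquiv.refl ℚ _) →
            ∃ (δ : Fin 2 → bettiCohomology (fiberOver (family ℂ n d) s') n) (c : ℚ),
              IsPicardLefschetzData n d 2 hn hd hU γ δ c ∧
                ∀ (σ' : fiberOver (family ℂ n d) s' ⟶ fiberOver (family ℂ n d) s'),
                  (∀ x : ComplexPoints (fiberOver (family ℂ n d) s'),
                      fibrePoint n d s' (AlgPoints.map σ' x) =
                        Projectivization.mk ℂ (a • (fibrePoint n d s' x).rep)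
                          ((smul_ne_zero_iff_ne a).mpr (Projectivization.rep_nonzero _))) →
                  BettiUniverse.pull σ' n (δ 0) = δ 1 ∨ BettiUniverse.pull σ' n (δ 0) = -δ 1 :=
  picardLefschetz_exchangedPair_of_supplier n d hn hd f₁ (a' • X i ^ d) hf₁
    ((homogeneousSubmodule (Fin (n + 2)) ℂ d).smul_mem a' (isHomogeneous_X_pow i d))
    (fun F hF z hz hgz => H n d hn hd F hF z hz i a' hgz) p hnod hgp a ha₁ hag h10

/-- **hPL₂exch for the pure monomial direction `g = xᵢ^d`, UNCONDITIONALLY** — the body of `picardLefschetz_exchangedPair` at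
`g := X i ^ d` (the shape applied by the K1-B consumer at `g₃ = x₂^d`): for every two-nodal `f₁` of degree `d` with nodes off
`xᵢ = 0` exchanged (`a • p₁ = t p₀`) by a diagonal `a` stabilising `f₁` and `xᵢ^d`. From `picardLefschetz_exchangedPair_monomial`
at `a′ = 1`. [cite: VoisinHodgeII2003, §3.2.1 Thm. 3.16, Cor. 3.17, Rem. 3.21 and §2.3.2]
[cite: ArnoldGuseinzadeVarchenko2012, Part I §1.3 and §2.1] [cite: Lamotke1981, §6] -/
theorem picardLefschetz_exchangedPair_X_pow (n d : ℕ) (hn : 1 ≤ n) (hd : 1 ≤ d)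
    (f₁ : MvPolynomial (Fin (n + 2)) ℂ) (hf₁ : f₁.IsHomogeneous d) (i : Fin (n + 2))
    (p : Fin 2 → Fin (n + 2) → ℂ) (hnod : IsNodalFormWithNodes f₁ p)
    (hgp : ∀ j, eval (p j) (X i ^ d : MvPolynomial (Fin (n + 2)) ℂ) ≠ 0)
    (a : Fin (n + 2) → ℂˣ) (ha₁ : a ∈ diagonalStabilizer f₁)
    (hag : a ∈ diagonalStabilizer (X i ^ d : MvPolynomial (Fin (n + 2)) ℂ)) (h10 : ∃ t : ℂ, a • p 1 = t • p 0) :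
    ∃ ε₀ : ℝ, 0 < ε₀ ∧
      (∀ c' : ℂ, c' ≠ 0 → ‖c'‖ < ε₀ →
        SmoothHypersurface.IsNonsingularForm ℂ (f₁ + c' • (X i ^ d : MvPolynomial (Fin (n + 2)) ℂ))) ∧
      ∀ (hU : IsCohomologicallyLocallyTrivialOn (family ℂ n d) Set.univ) (ε : ℝ), 0 < ε → ε < ε₀ →
        ∀ (s' : ComplexPoints (base ℂ n d)),
          pointForm ℂ n d s' = f₁ + (ε : ℂ) • (X i ^ d : MvPolynomial (Fin (n + 2)) ℂ) →
          ∀ (γ : Path s' s'), IsPencilCircle n d f₁ (X i ^ d) ε γ →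
            (Even n → ∀ T : bettiCohomology (fiberOver (family ℂ n d) s') n ≃ₗ[ℚ]
                bettiCohomology (fiberOver (family ℂ n d) s') n,
              IsRatTransport (family ℂ n d) n hU (loopClassUniv n d γ) T → T ≠ LinearEquiv.refl ℚ _) →
            ∃ (δ : Fin 2 → bettiCohomology (fiberOver (family ℂ n d) s') n) (c : ℚ),
              IsPicardLefschetzData n d 2 hn hd hU γ δ c ∧
                ∀ (σ' : fiberOver (family ℂ n d) s' ⟶ fiberOver (family ℂ n d) s'),
                  (∀ x : ComplexPoints (fiberOver (family ℂ n d) s'),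
                      fibrePoint n d s' (AlgPoints.map σ' x) =
                        Projectivization.mk ℂ (a • (fibrePoint n d s' x).rep)
                          ((smul_ne_zero_iff_ne a).mpr (Projectivization.rep_nonzero _))) →
                  BettiUniverse.pull σ' n (δ 0) = δ 1 ∨ BettiUniverse.pull σ' n (δ 0) = -δ 1 := by
  have h := picardLefschetz_exchangedPair_monomial n d hn hd f₁ hf₁ i 1 p hnod (by simpa only [one_smul] using hgp) a ha₁
    (by simpa only [one_smul] using hag) h10
  simpa only [one_smul] using h


/-- **hPL₂exch for a direction which is a monomial up to a scalar (`∃ i a′, g = a′ • xᵢ^d`), UNCONDITIONALLY** — the consumer shape of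
`PicardLefschetzOneNodeMonomialShapes` (general `g` with the side hypothesis `hgX`; the homogeneity binder is kept, unused, so that the port is positional): the body of `picardLefschetz_exchangedPair` for
`(f₁, g, p, a)`. Port recipe for `transvections_of_exchanged_pair_keyed`: replace `(H : picardLefschetz_exchangedPair)` by `hgX` and the
call `H n d hn hd f₁ g hf₁ hg q hnod hgp γ hγfin hγ₁ hγg hq` by
`picardLefschetz_exchangedPair_of_exists_monomial n d hn hd f₁ g hf₁ hg hgX q hnod hgp γ hγ₁ hγg hq`.
[cite: VoisinHodgeII2003, §3.2.1 Thm. 3.16, Cor. 3.17, Rem. 3.21 and §2.3.2] [cite: ArnoldGuseinzadeVarchenko2012, Part I §1.3 and §2.1]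
[cite: Lamotke1981, §6] -/
theorem picardLefschetz_exchangedPair_of_exists_monomial (n d : ℕ) (hn : 1 ≤ n) (hd : 1 ≤ d)
    (f₁ g : MvPolynomial (Fin (n + 2)) ℂ) (hf₁ : f₁.IsHomogeneous d) (_hg : g.IsHomogeneous d)
    (hgX : ∃ (i : Fin (n + 2)) (a' : ℂ), g = a' • X i ^ d)
    (p : Fin 2 → Fin (n + 2) → ℂ) (hnod : IsNodalFormWithNodes f₁ p) (hgp : ∀ j, eval (p j) g ≠ 0)
    (a : Fin (n + 2) → ℂˣ) (ha₁ : a ∈ diagonalStabilizer f₁) (hag : a ∈ diagonalStabilizer g)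
    (h10 : ∃ t : ℂ, a • p 1 = t • p 0) :
    ∃ ε₀ : ℝ, 0 < ε₀ ∧
      (∀ c' : ℂ, c' ≠ 0 → ‖c'‖ < ε₀ → SmoothHypersurface.IsNonsingularForm ℂ (f₁ + c' • g)) ∧
      ∀ (hU : IsCohomologicallyLocallyTrivialOn (family ℂ n d) Set.univ) (ε : ℝ), 0 < ε → ε < ε₀ →
        ∀ (s' : ComplexPoints (base ℂ n d)), pointForm ℂ n d s' = f₁ + (ε : ℂ) • g →
          ∀ (γ : Path s' s'), IsPencilCircle n d f₁ g ε γ →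
            (Even n → ∀ T : bettiCohomology (fiberOver (family ℂ n d) s') n ≃ₗ[ℚ]
                bettiCohomology (fiberOver (family ℂ n d) s') n,
              IsRatTransport (family ℂ n d) n hU (loopClassUniv n d γ) T → T ≠ LinearEquiv.refl ℚ _) →
            ∃ (δ : Fin 2 → bettiCohomology (fiberOver (family ℂ n d) s') n) (c : ℚ),
              IsPicardLefschetzData n d 2 hn hd hU γ δ c ∧
                ∀ (σ' : fiberOver (family ℂ n d) s' ⟶ fiberOver (family ℂ n d) s'),
                  (∀ x : ComplexPoints (fiberOver (family ℂ n d) s'),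
                      fibrePoint n d s' (AlgPoints.map σ' x) =
                        Projectivization.mk ℂ (a • (fibrePoint n d s' x).rep)
                          ((smul_ne_zero_iff_ne a).mpr (Projectivization.rep_nonzero _))) →
                  BettiUniverse.pull σ' n (δ 0) = δ 1 ∨ BettiUniverse.pull σ' n (δ 0) = -δ 1 := by
  obtain ⟨i, a', rfl⟩ := hgX
  exact picardLefschetz_exchangedPair_monomial n d hn hd f₁ hf₁ i a' p hnod hgp a ha₁ hag h10

end Literature.AlgebraicGeometry.HodgeTheory

end
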